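import Literature.Geometry.PolyhedralFans.MultiStarDescent
import HarnessLib

/-!
# The synchronised regularisation loop for a FAMILY of fans (KKMS II §2 by charts)

Topic: `Literature/Geometry/PolyhedralFans` (block A5 of the LINKED-KKMS programme; summit
`ResolutionOfSingularities`, W8.1 / Kato (10.4) atlas form). In [KempfEtAl1973] Ch. II §2 the
multiplicity descent of Ch. I §2 Thm. 11 ([Fulton1993Toric] §2.6; [Ewald1996] VI Thm. 8.5) runs
on all charts of a conical complex at once: one step subdivides EVERY chart at the points of one
orbit of a parallelotope point, and the measure is global — (largest count over all charts,
number of cones of that count over all charts). This file is the family version of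
res-type-037's `Fan.exists_regular_starIter_of_invariant` (`MultiStarDescent.lean`, one fan):

* `Fan.multiStep_parPoints_le` — the per-member step WITHOUT the hypothesis that the carrying
  cone has maximal count (the new cones have count `< m` by `pmult_insert_lt_of_mem` in any
  case; in a member other than the one where the point was chosen, the transported point is a
  parallelotope point of the transported cone, whose count need not be maximal there);
* `Fan.familyMaxPMult`, `Fan.familyNumMax` — the global measure of a family;
* `Fan.exists_regular_family_of_invariant` — **the family loop**: for any property `I` of
  families, if from every primitively simplicial, not everywhere regular family satisfying `I`
  one can produce separated duplicate-free lists of primitive parallelotope points in the members,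
  one of which lies in a cone of globally maximal count, with `I` again after the simultaneous
  star subdivisions, then some simultaneous iterated star subdivision is regular and primitively
  simplicial in every member, refines, and satisfies `I`.

References: [KempfEtAl1973] Ch. I §2 Thm. 11, Ch. II §2; [Fulton1993Toric] §2.6 p. 48;
[Ewald1996] VI Thm. 8.5.
-/

noncomputable section

namespace Literature.Geometry.PolyhedralFans

open PointedCone Finset

namespace Fan

variable {κ : Type*} [Fintype κ] [DecidableEq κ]

/-! ## The per-member step without the maximality hypothesis -/

/-- One prescribed step, the carrying cone of any count: in a primitively simplicial fan with all
counts `≤ m`, after the star subdivision through a primitive parallelotope point `w = Σ a_s s` of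
a cone `σ` (generators `S`), all counts are `≤ m` and the cones of count `m` are old cones not
containing `w`. (Proof of `conePMult_starSubdivision_parPoint`, which never uses `conePMult σ = m`.)
[cite: Fulton1993Toric, §2.6 p. 48] -/
theorem conePMult_starSubdivision_parPoint_le {Δ : Fan ℚ (κ → ℚ)} (hΔ : Δ.IsPrimSimplicial)
    {m : ℕ} (hm : ∀ ρ ∈ Δ.cones, conePMult ρ ≤ m) {σ : PointedCone ℚ (κ → ℚ)} (hσ : σ ∈ Δ.cones)
    {S : Finset (κ → ℚ)} (hS : IsPrimGens σ S)
    {a : (κ → ℚ) → ℚ} (ha : a ∈ parCoeffs S) (hw : IsPrimitive (∑ s ∈ S, a s • s))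
    {ρ' : PointedCone ℚ (κ → ℚ)} (hρ' : ρ' ∈ (Δ.starSubdivision (∑ s ∈ S, a s • s)).cones) :
    conePMult ρ' ≤ m ∧
      (conePMult ρ' = m → ρ' ∈ Δ.cones ∧ (∑ s ∈ S, a s • s) ∉ ρ') := by
  set w := ∑ s ∈ S, a s • s with hwdef
  rw [starSubdivision_cones] at hρ'
  rcases mem_starCones_iff.mp hρ' with ⟨hρ'Δ, hwρ'⟩ | ⟨τ, hτ, hwτ, ⟨σ'', hσ'', hτσ'', hwσ''⟩, rfl⟩
  · exact ⟨hm ρ' hρ'Δ, fun _ => ⟨hρ'Δ, hwρ'⟩⟩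
  · obtain ⟨S'', hS''⟩ := hΔ.exists_isPrimGens hσ''
    obtain ⟨T, hT⟩ := hΔ.exists_isPrimGens hτ
    have hnew : IsPrimGens (τ ⊔ ray ℚ w) (insert w T) := by
      refine ⟨?_, ?_, ?_⟩
      · intro s hs
        rcases Finset.mem_insert.mp hs with rfl | hs
        · exact hw
        · exact hT.1 s hs
      · rw [Finset.coe_insert]
        refine hT.2.1.id_insert fun hwspan => hwτ ?_
        have hface : τ.IsFaceOf σ'' := isFaceOf_of_le hσ'' hτ hτσ''
        refine mem_of_isFaceOf_of_mem_span hface hwσ'' ?_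
        rwa [hT.2.2, span_coe_hull]
      · rw [Finset.coe_insert, hull_insert, ← hT.2.2]
    have hlt : conePMult (τ ⊔ ray ℚ w) < m := by
      rw [conePMult_eq hnew]
      calc pmult (insert w T) < pmult S'' :=
            pmult_insert_lt_of_mem hσ hσ'' hτ hτσ'' hS hS'' hT ha hwσ'' hwτ
        _ = conePMult σ'' := (conePMult_eq hS'').symm
        _ ≤ m := hm σ'' hσ''
    exact ⟨hlt.le, fun h => absurd h hlt.ne⟩

/-- **Synchronised step in one member, carrying cones of any count**: `Δ` primitively simplicial
with all counts `≤ m`, `l` a duplicate-free SEPARATED list of primitive parallelotope points of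
cones of `Δ`; then `Δ.starIter l` is primitively simplicial, all counts are `≤ m`, and its cones
of count `m` are cones of `Δ` containing none of the points. [cite: Fulton1993Toric, §2.6 p. 48] -/
theorem multiStep_parPoints_le {m : ℕ} : ∀ (l : List (κ → ℚ)) {Δ : Fan ℚ (κ → ℚ)},
    Δ.IsPrimSimplicial → (∀ ρ ∈ Δ.cones, conePMult ρ ≤ m) →
    (∀ z ∈ l, IsPrimitive z ∧ ∃ σ ∈ Δ.cones, ∃ S : Finset (κ → ℚ), IsPrimGens σ S ∧
      ∃ a ∈ parCoeffs S, z = ∑ s ∈ S, a s • s) →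
    l.Nodup → (∀ σ ∈ Δ.cones, ∀ z ∈ l, ∀ z' ∈ l, z ∈ σ → z' ∈ σ → z = z') →
    (Δ.starIter l).IsPrimSimplicial ∧
      ∀ ρ' ∈ (Δ.starIter l).cones, conePMult ρ' ≤ m ∧
        (conePMult ρ' = m → ρ' ∈ Δ.cones ∧ ∀ z ∈ l, z ∉ ρ')
  | [], _, hΔ, hm, _, _, _ => ⟨hΔ, fun ρ' hρ' => ⟨hm ρ' hρ', fun _ => ⟨hρ', fun _ h => by simp at h⟩⟩⟩
  | z :: l, Δ, hΔ, hm, hZ, hnd, hsep => by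
    have hzl : z ∉ l := (List.nodup_cons.mp hnd).1
    have hnd' : l.Nodup := (List.nodup_cons.mp hnd).2
    obtain ⟨hzprim, σ, hσ, S, hS, a, ha, hza⟩ := hZ z List.mem_cons_self
    have hΔ' : (Δ.starSubdivision z).IsPrimSimplicial :=
      isPrimSimplicial_starSubdivision_of_isPrimitive hΔ hzprim
    have hstep : ∀ ρ' ∈ (Δ.starSubdivision z).cones, conePMult ρ' ≤ m ∧
        (conePMult ρ' = m → ρ' ∈ Δ.cones ∧ z ∉ ρ') := by
      intro ρ' hρ'
      have hw : IsPrimitive (∑ s ∈ S, a s • s) := hza ▸ hzprim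
      have hρ'' : ρ' ∈ (Δ.starSubdivision (∑ s ∈ S, a s • s)).cones := hza ▸ hρ'
      have := conePMult_starSubdivision_parPoint_le hΔ hm hσ hS ha hw hρ''
      rwa [← hza] at this
    have hzz : ∀ z' ∈ l, ∀ σ' ∈ Δ.cones, z ∈ σ' → z' ∈ σ' → False := by
      intro z' hz' σ' hσ' hz hz'σ'
      have := hsep σ' hσ' z List.mem_cons_self z' (List.mem_cons_of_mem z hz') hz hz'σ'
      exact hzl (this ▸ hz')
    have hZ' : ∀ z' ∈ l, IsPrimitive z' ∧ ∃ σ' ∈ (Δ.starSubdivision z).cones,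
        ∃ S' : Finset (κ → ℚ), IsPrimGens σ' S' ∧ ∃ a' ∈ parCoeffs S', z' = ∑ s ∈ S', a' s • s := by
      intro z' hz'
      obtain ⟨hz'prim, σ', hσ', S', hS', a', ha', hz'a⟩ := hZ z' (List.mem_cons_of_mem z hz')
      have hz'σ' : z' ∈ σ' := by
        rw [hz'a, hS'.2.2]; exact sum_smul_mem_hull fun s hs => (ha'.1 s hs).1
      have hzσ' : z ∉ σ' := fun h => hzz z' hz' σ' hσ' h hz'σ'
      exact ⟨hz'prim, σ', mem_starCones_of_not_mem hσ' hzσ', S', hS', a', ha', hz'a⟩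
    have hsep' : ∀ σ' ∈ (Δ.starSubdivision z).cones, ∀ z₁ ∈ l, ∀ z₂ ∈ l,
        z₁ ∈ σ' → z₂ ∈ σ' → z₁ = z₂ := by
      intro σ' hσ' z₁ hz₁ z₂ hz₂ h₁ h₂
      obtain ⟨σ₀, hσ₀, hle⟩ := starSubdivision_exists_le hσ'
      exact hsep σ₀ hσ₀ z₁ (List.mem_cons_of_mem z hz₁) z₂ (List.mem_cons_of_mem z hz₂)
        (hle h₁) (hle h₂)
    obtain ⟨hps, hcnt⟩ := multiStep_parPoints_le l hΔ' (fun ρ' hρ' => (hstep ρ' hρ').1) hZ' hnd' hsep'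
    rw [starIter_cons]
    refine ⟨hps, fun ρ' hρ' => ⟨(hcnt ρ' hρ').1, fun h => ?_⟩⟩
    obtain ⟨hρ'1, hno⟩ := (hcnt ρ' hρ').2 h
    obtain ⟨hρ'Δ, hzρ'⟩ := (hstep ρ' hρ'1).2 h
    refine ⟨hρ'Δ, fun w hw => ?_⟩
    rcases List.mem_cons.mp hw with rfl | hw
    · exact hzρ'
    · exact hno w hw

/-! ## The global measure of a family -/

variable {ι : Type*} [Fintype ι] {n : ι → ℕ}

/-- The **largest count over a family** of fans. [cite: Ewald1996, VI Thm. 8.5] -/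
def familyMaxPMult (Γ : ∀ i, Fan ℚ (Fin (n i) → ℚ)) : ℕ := Finset.univ.sup fun i => (Γ i).maxPMult

/-- The **number of cones, over all members, attaining the largest count**. [cite: Ewald1996, VI Thm. 8.5] -/
def familyNumMax (Γ : ∀ i, Fan ℚ (Fin (n i) → ℚ)) : ℕ :=
  ∑ i, ((Γ i).finite.toFinset.filter fun ρ => conePMult ρ = familyMaxPMult Γ).card

/-- Every count in every member is at most the family maximum. [cite: Ewald1996, VI Thm. 8.5] -/
theorem conePMult_le_familyMaxPMult (Γ : ∀ i, Fan ℚ (Fin (n i) → ℚ)) {i : ι}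
    {ρ : PointedCone ℚ (Fin (n i) → ℚ)} (hρ : ρ ∈ (Γ i).cones) : conePMult ρ ≤ familyMaxPMult Γ :=
  (conePMult_le_maxPMult hρ).trans (Finset.le_sup (f := fun i => (Γ i).maxPMult) (Finset.mem_univ i))

/-- A member's maximal count is at most the family maximum. [cite: Ewald1996, VI Thm. 8.5] -/
theorem maxPMult_le_familyMaxPMult (Γ : ∀ i, Fan ℚ (Fin (n i) → ℚ)) (i : ι) :
    (Γ i).maxPMult ≤ familyMaxPMult Γ :=
  Finset.le_sup (f := fun i => (Γ i).maxPMult) (Finset.mem_univ i)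

/-- **The family loop** ([Ewald1996] VI Thm. 8.5 / [KempfEtAl1973] II §2, induction on the family
measure `(familyMaxPMult, familyNumMax)`): let `I` be a property of families of fans. Suppose
that from every family which is primitively simplicial in every member, NOT regular in some
member, and satisfies `I`, one can produce duplicate-free lists `l i` of primitive parallelotope
points of cones of the members, separated in each member, such that some point of some list lies
in a cone of GLOBALLY maximal count of its member, and `I` holds after the simultaneous iterated
star subdivisions. Then some simultaneous iterated star subdivision through nonzero lattice
vectors refines every member, is regular and primitively simplicial in every member, and
satisfies `I`. [cite: Ewald1996, VI Thm. 8.5] [cite: KempfEtAl1973, Ch. II §2] -/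
theorem exists_regular_family_of_invariant {I : (∀ i, Fan ℚ (Fin (n i) → ℚ)) → Prop}
    (step : ∀ Γ : ∀ i, Fan ℚ (Fin (n i) → ℚ), I Γ → (∀ i, (Γ i).IsPrimSimplicial) →
      (¬ ∀ i, (Γ i).IsRegular) →
      ∃ l : ∀ i, List (Fin (n i) → ℚ), (∀ i, (l i).Nodup) ∧
        (∀ i, ∀ z ∈ l i, IsPrimitive z ∧ ∃ σ ∈ (Γ i).cones, ∃ S : Finset (Fin (n i) → ℚ),
          IsPrimGens σ S ∧ ∃ a ∈ parCoeffs S, z = ∑ s ∈ S, a s • s) ∧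
        (∃ i₀, ∃ z ∈ l i₀, ∃ σ ∈ (Γ i₀).cones, conePMult σ = familyMaxPMult Γ ∧ z ∈ σ) ∧
        (∀ i, ∀ σ ∈ (Γ i).cones, ∀ z ∈ l i, ∀ z' ∈ l i, z ∈ σ → z' ∈ σ → z = z') ∧
        I (fun i => (Γ i).starIter (l i)))
    {Δ : ∀ i, Fan ℚ (Fin (n i) → ℚ)} (hI : I Δ) (hΔ : ∀ i, (Δ i).IsPrimSimplicial) :
    ∃ L : ∀ i, List (Fin (n i) → ℚ), (∀ i, ∀ w ∈ L i, w ∈ latticeN (Fin (n i)) ∧ w ≠ 0) ∧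
      (∀ i, ((Δ i).starIter (L i)).Refines (Δ i)) ∧ (∀ i, ((Δ i).starIter (L i)).IsRegular) ∧
      (∀ i, ((Δ i).starIter (L i)).IsPrimSimplicial) ∧ I (fun i => (Δ i).starIter (L i)) := by
  classical
  suffices h : ∀ M N : ℕ, ∀ Δ : ∀ i, Fan ℚ (Fin (n i) → ℚ), I Δ → (∀ i, (Δ i).IsPrimSimplicial) →
      familyMaxPMult Δ = M → familyNumMax Δ = N →
      ∃ L : ∀ i, List (Fin (n i) → ℚ), (∀ i, ∀ w ∈ L i, w ∈ latticeN (Fin (n i)) ∧ w ≠ 0) ∧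
        (∀ i, ((Δ i).starIter (L i)).Refines (Δ i)) ∧ (∀ i, ((Δ i).starIter (L i)).IsRegular) ∧
        (∀ i, ((Δ i).starIter (L i)).IsPrimSimplicial) ∧ I (fun i => (Δ i).starIter (L i)) from
    h _ _ Δ hI hΔ rfl rfl
  intro M
  induction M using Nat.strong_induction_on with
  | _ M ihM =>
    intro N
    induction N using Nat.strong_induction_on with
    | _ N ihN =>
      intro Δ hI hΔ hM hN
      by_cases hreg : ∀ i, (Δ i).IsRegular
      · exact ⟨fun _ => [], fun _ _ h => absurd h List.not_mem_nil, fun i => Refines.refl _, hreg, hΔ, hI⟩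
      · obtain ⟨l, hlnd, hZ, ⟨i₀, z₀, hz₀, σ₀, hσ₀, hσ₀M, hz₀σ₀⟩, hsep, hI'⟩ := step Δ hI hΔ hreg
        set Δ' : ∀ i, Fan ℚ (Fin (n i) → ℚ) := fun i => (Δ i).starIter (l i) with hΔ'
        -- per member: primitively simplicial, counts ≤ M, count-M cones are old and avoid the points
        have hmem : ∀ i, (Δ' i).IsPrimSimplicial ∧ ∀ ρ' ∈ (Δ' i).cones, conePMult ρ' ≤ M ∧
            (conePMult ρ' = M → ρ' ∈ (Δ i).cones ∧ ∀ z ∈ l i, z ∉ ρ') := fun i =>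
          multiStep_parPoints_le (l i) (hΔ i) (fun ρ hρ => hM ▸ conePMult_le_familyMaxPMult Δ hρ)
            (hZ i) (hlnd i) (hsep i)
        have hps' : ∀ i, (Δ' i).IsPrimSimplicial := fun i => (hmem i).1
        have hl0 : ∀ i, ∀ w ∈ l i, w ∈ latticeN (Fin (n i)) ∧ w ≠ 0 :=
          fun i w hw => ⟨(hZ i w hw).1.1, (hZ i w hw).1.2.1⟩
        have hlsupp : ∀ i, ∀ w ∈ l i, w ∈ (Δ i).support := by
          intro i w hw
          obtain ⟨-, σ, hσ, S, hS, a, ha, hwa⟩ := hZ i w hw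
          refine mem_support.mpr ⟨σ, hσ, ?_⟩
          rw [hwa, hS.2.2]; exact sum_smul_mem_hull fun s hs => (ha.1 s hs).1
        have hstep : ∀ i, (Δ' i).Refines (Δ i) := fun i =>
          starIter_refines_of_mem_support (l i) (hlsupp i) fun w hw => (hl0 i w hw).2
        -- the measure drops
        have hM'le : familyMaxPMult Δ' ≤ M :=
          Finset.sup_le fun i _ => Finset.sup_le fun ρ' hρ' =>
            ((hmem i).2 ρ' ((Δ' i).finite.mem_toFinset.mp hρ')).1
        have hlex : familyMaxPMult Δ' < M ∨ (familyMaxPMult Δ' = M ∧ familyNumMax Δ' < N) := by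
          rcases hM'le.lt_or_eq with hlt | heq
          · exact Or.inl hlt
          · refine Or.inr ⟨heq, ?_⟩
            rw [← hN, familyNumMax, familyNumMax, heq, hM]
            -- termwise `≤`, strict at `i₀`
            have hle : ∀ i, ((Δ' i).finite.toFinset.filter fun ρ => conePMult ρ = M).card ≤
                ((Δ i).finite.toFinset.filter fun ρ => conePMult ρ = M).card := by
              intro i
              apply Finset.card_le_card
              intro ρ' hρ'
              obtain ⟨hρ'fin, hρ'M⟩ := Finset.mem_filter.mp hρ'
              obtain ⟨hρ'Δ, -⟩ := ((hmem i).2 ρ' ((Δ' i).finite.mem_toFinset.mp hρ'fin)).2 hρ'M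
              exact Finset.mem_filter.mpr ⟨(Δ i).finite.mem_toFinset.mpr hρ'Δ, hρ'M⟩
            have hlt : ((Δ' i₀).finite.toFinset.filter fun ρ => conePMult ρ = M).card <
                ((Δ i₀).finite.toFinset.filter fun ρ => conePMult ρ = M).card := by
              apply Finset.card_lt_card
              refine ⟨fun ρ' hρ' => ?_, fun hsub => ?_⟩
              · obtain ⟨hρ'fin, hρ'M⟩ := Finset.mem_filter.mp hρ'
                obtain ⟨hρ'Δ, -⟩ := ((hmem i₀).2 ρ' ((Δ' i₀).finite.mem_toFinset.mp hρ'fin)).2 hρ'M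
                exact Finset.mem_filter.mpr ⟨(Δ i₀).finite.mem_toFinset.mpr hρ'Δ, hρ'M⟩
              · have hσin : σ₀ ∈ (Δ i₀).finite.toFinset.filter fun ρ => conePMult ρ = M :=
                  Finset.mem_filter.mpr ⟨(Δ i₀).finite.mem_toFinset.mpr hσ₀, hM ▸ hσ₀M⟩
                obtain ⟨hσfin', hσM'⟩ := Finset.mem_filter.mp (hsub hσin)
                obtain ⟨-, hno⟩ := ((hmem i₀).2 σ₀ ((Δ' i₀).finite.mem_toFinset.mp hσfin')).2 hσM'
                exact hno z₀ hz₀ hz₀σ₀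
            exact Finset.sum_lt_sum (fun i _ => hle i) ⟨i₀, Finset.mem_univ _, hlt⟩
        obtain ⟨L, hL, href, hreg', hps'', hI''⟩ : ∃ L : ∀ i, List (Fin (n i) → ℚ),
            (∀ i, ∀ w ∈ L i, w ∈ latticeN (Fin (n i)) ∧ w ≠ 0) ∧
            (∀ i, ((Δ' i).starIter (L i)).Refines (Δ' i)) ∧ (∀ i, ((Δ' i).starIter (L i)).IsRegular) ∧
            (∀ i, ((Δ' i).starIter (L i)).IsPrimSimplicial) ∧ I (fun i => (Δ' i).starIter (L i)) := by
          rcases hlex with h1 | ⟨h1, h2⟩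
          · exact ihM _ h1 _ _ hI' hps' rfl rfl
          · exact ihN _ h2 _ hI' hps' h1 rfl
        refine ⟨fun i => l i ++ L i, fun i v hv => ?_, fun i => ?_, fun i => ?_, fun i => ?_, ?_⟩
        · rcases List.mem_append.mp hv with hv | hv
          · exact hl0 i v hv
          · exact hL i v hv
        · rw [starIter_append]; exact (href i).trans (hstep i)
        · rw [starIter_append]; exact hreg' i
        · rw [starIter_append]; exact hps'' i
        · have : (fun i => (Δ i).starIter (l i ++ L i)) = fun i => (Δ' i).starIter (L i) := by
            funext i; rw [starIter_append]
          rw [this]; exact hI''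

end Fan

end Literature.Geometry.PolyhedralFans
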